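import Mathlib
import HarnessLib
import Summits.NavierStokesRegularity.NavierStokesRegularity.Theorems.CompletionRelayChainPhaseISoundFinal

/-!
# Route `CompletionRelayChain` — crux `RelayFrontStep` (stmt-NavierStokesRegularity-24850), K-side of `stub_phaseI`,
  work package K5-j: THE ASSEMBLED SOUNDNESS THEOREM — the conclusions of `stub_phaseI` from
  `∀ cell ∈ cells, checkCell cell = true`, modulo the shell-2 energy bound `Shell2Bound`

MODEL-lattice bookkeeping (rung TL-M3-R64); nothing here is a statement about the Navier–Stokes equations.
-/

noncomputable section

set_option linter.dupNamespace false

namespace Summit.NavierStokesRegularity.NavierStokesRegularity.Cruxes.RelayFrontStep.PhaseI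

open Set Checker MeasureTheory
open Literature.Analysis.FluidPDE.TaoCascade

attribute [local irreducible] Checker.step Checker.boxGuess Checker.bSearch iter Checker.checkCell

variable {α : Fin 4 → Fin 4 → Fin 4 → ℤ × ℤ × ℤ → ℝ} {τ : ℝ} {S₀ F₀ B₀ : Fin 4 → ℤ → ℝ} {S F : Fin 4 → ℤ → ℝ → ℝ}

/-- `147·h = T*`. [this file] -/
theorem nSteps_hR : ((147 : ℕ) : ℝ) * hR = Window2.Tstar := by
  simp [hR, Window2.Tstar]; norm_num

/-- The start parameter values of the flow. [this file] -/
def startY (S : Fin 4 → ℤ → ℝ → ℝ) : Fin 7 → ℝ := fun j => zc S 0 (paramComp j)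

/-- The start parameter values lie in the parameter ranges of the grid (`W₃`). [this file] -/
theorem startY_mem (H : Hyps α τ S₀ F₀ B₀ S F) (j : Fin 7) :
    (((prange j).1 : ℚ) : ℝ) ≤ startY S j ∧ startY S j ≤ (((prange j).2 : ℚ) : ℝ) := by
  obtain ⟨_, _, w3, w4, w5, w6, w7, w8, _, _, _, wwake, _⟩ := H.hW
  obtain ⟨_, _, z32, z40, z41, _, _, _, _, z20, z21, z22⟩ := zc_table S 0
  obtain ⟨_, _, _, _, z11, _⟩ := zc_table2 S 0
  have hi := H.hflow.init_S
  obtain ⟨wk1, wk2, _⟩ := wakeS_vals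
  have hwm1 := wwake (-1) (by norm_num); have hwm2 := wwake (-2) (by norm_num)
  rw [wk1] at hwm1; rw [wk2] at hwm2
  have hm1 : ∀ i : Fin 4, |S i (-1) 0| ≤ ((rtHalf : ℚ) : ℝ) := fun i =>
    abs_start_le H i (-1) (by norm_num [rtHalf]) (by simp only [rtHalf]; push_cast; linarith)
  have hm2 : ∀ i : Fin 4, |S i (-2) 0| ≤ 1 := fun i => abs_start_le H i (-2) (by norm_num) (by linarith)
  unfold startY
  fin_cases j <;> simp only [paramComp, prange, Matrix.cons_val_zero, Matrix.cons_val_one, Matrix.head_cons,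
    Matrix.cons_val_two, Matrix.tail_cons, Fin.mk_zero, Fin.mk_one, Fin.reduceFinMk, Matrix.cons_val]
  · rw [z40, hi]; push_cast; exact ⟨by linarith [w5], by linarith [w6]⟩
  · rw [z32, hi]; push_cast; exact ⟨by linarith [w3], by linarith [w4]⟩
  · rw [z41, hi]; push_cast; exact ⟨by linarith [w7], by linarith [w8]⟩
  · rw [z20]; have := abs_le.1 (hm1 0); push_cast; exact this
  · rw [z21]; have := abs_le.1 (hm1 1); push_cast; exact this
  · rw [z11]; have := abs_le.1 (hm2 1); push_cast; exact this
  · rw [z22]; have := abs_le.1 (hm1 2); push_cast; exact this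

/-- **MAIN SOUNDNESS THEOREM (modulo `Shell2Bound`)**: if every grid cell passes the checker, the conclusions of
`stub_phaseI` hold for every pseudo-flow satisfying its hypotheses. [this file] -/
theorem phaseI_main (H : Hyps α τ S₀ F₀ B₀ S F) (h2 : Shell2Bound F₀ S F)
    (hall : ∀ cell ∈ cells, checkCell cell = true) :
    Window2.PhaseIEndBox S F ∧ Window2.PhaseIEnvelope S ∧
      (∀ s ∈ Icc (0:ℝ) Window2.Tstar, ∀ (i : Fin 4) (k : ℤ), 0 ≤ k → k ≤ 2 → i ≠ 3 → F i k s ≤ Window2.relayEnv₂ k) ∧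
      (∫ s in (0:ℝ)..Window2.Tstar, S 1 2 s ^ 2) ≤ Window2.iota₁ ∧
      (∫ s in (0:ℝ)..Window2.Tstar, |S 2 2 s * S 1 2 s|) ≤ Window2.iota₂ := by
  -- the cell and the parameter point
  obtain ⟨cell, hcell, hin⟩ := exists_cell (startY S) (startY_mem H)
  set θ : Fin 7 → ℝ := fun j => (startY S j - (pmid cell j : ℝ)) / (prad cell j : ℝ) with hθdef
  have hrad : ∀ j, (0 : ℝ) < (prad cell j : ℝ) := fun j => by
    have := (hin j).2.2; simp only [prad]; push_cast
    have : ((cell.plo j : ℚ) : ℝ) < cell.phi j := by exact_mod_cast this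
    linarith
  have hθeq : ∀ j, zc S 0 (paramComp j) = (pmid cell j : ℝ) + (prad cell j : ℝ) * θ j := by
    intro j
    have hr := hrad j
    have e : (prad cell j : ℝ) * ((startY S j - pmid cell j) / prad cell j) = startY S j - pmid cell j :=
      mul_div_cancel₀ _ (ne_of_gt hr)
    rw [hθdef]; simp only [startY] at e ⊢
    linarith
  have hθbox : TM.InBox θ := by
    intro j
    obtain ⟨h1, h2, _⟩ := hin j
    have hr := hrad j
    rw [hθdef]; simp only
    rw [abs_div, abs_of_pos hr, div_le_one hr, abs_le]
    simp only [pmid, prad] at hr ⊢; push_cast at hr ⊢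
    simp only [startY] at h1 h2 ⊢
    constructor <;> linarith
  -- the run
  obtain ⟨hok, hfoot⟩ := checkCell_spec (hall cell hcell)
  have hstart := nodeInv_start H hθeq
  have hinv := nodeInv_iter H h2 hθbox hstart hok 147 le_rfl
  obtain ⟨hT, hI1, hI2, _, henv⟩ := hinv
  rw [nSteps_hR] at hT hI1 hI2 henv
  -- the footer
  simp only [footer, Bool.and_eq_true, decide_eq_true_eq] at hfoot
  obtain ⟨⟨⟨⟨⟨hEB, hEcap⟩, hx12⟩, hc2⟩, hpre⟩, hI⟩ := hfoot
  have hTT : (0:ℝ) ≤ Window2.Tstar ∧ Window2.Tstar ≤ 147 / 64 := by simp [Window2.Tstar]; norm_num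
  -- amplitude read-out
  have hA : ∀ c : Fin 19, (((endBox c).lo : ℚ) : ℝ) ≤ zc S Window2.Tstar c ∧ zc S Window2.Tstar c ≤ (((endBox c).hi : ℚ) : ℝ) := by
    intro c
    obtain ⟨e1, e2⟩ := hEB c
    exact ⟨le_trans (by exact_mod_cast e1) (TM.lo2_le _ hθbox (hT c)), le_trans (TM.le_hi2 _ hθbox (hT c)) (by exact_mod_cast e2)⟩
  obtain ⟨z30, z31, z32, z40, z41, z42, z50, z51, z52, z20, z21, z22⟩ := zc_table S Window2.Tstar
  obtain ⟨z00, z01, z02, z10, z11, z12⟩ := zc_table2 S Window2.Tstar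
  have r00 := hA (cix 0 0); have r01 := hA (cix 0 1); have r02 := hA (cix 0 2)
  have r10 := hA (cix 1 0); have r11 := hA (cix 1 1); have r12 := hA (cix 1 2)
  have r20 := hA (cix 2 0); have r21 := hA (cix 2 1); have r22 := hA (cix 2 2)
  have r30 := hA (cix 3 0); have r31 := hA (cix 3 1); have r32 := hA (cix 3 2)
  have r40 := hA (cix 4 0); have r41 := hA (cix 4 1); have r42 := hA (cix 4 2)
  have r50 := hA (cix 5 0); have r51 := hA (cix 5 1); have r52 := hA (cix 5 2)
  rw [z00, show endBox (cix 0 0) = ⟨-(1441 / 1000), 1454 / 1000⟩ from rfl] at r00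
  rw [z01, show endBox (cix 0 1) = ⟨-(1461 / 1000), 1461 / 1000⟩ from rfl] at r01
  rw [z02, show endBox (cix 0 2) = ⟨-(1416 / 1000), 1416 / 1000⟩ from rfl] at r02
  rw [z10, show endBox (cix 1 0) = ⟨-(1109 / 1000), 1035 / 1000⟩ from rfl] at r10
  rw [z11, show endBox (cix 1 1) = ⟨-(1147 / 1000), 1147 / 1000⟩ from rfl] at r11
  rw [z12, show endBox (cix 1 2) = ⟨-(1004 / 1000), 1004 / 1000⟩ from rfl] at r12
  rw [z20, show endBox (cix 2 0) = ⟨-(8505 / 10000), 8019 / 10000⟩ from rfl] at r20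
  rw [z21, show endBox (cix 2 1) = ⟨-(7561 / 10000), 7561 / 10000⟩ from rfl] at r21
  rw [z22, show endBox (cix 2 2) = ⟨-(7085 / 10000), 7085 / 10000⟩ from rfl] at r22
  rw [z30, show endBox (cix 3 0) = ⟨-(3213 / 100000), 2755 / 10000⟩ from rfl] at r30
  rw [z31, show endBox (cix 3 1) = ⟨3695 / 10000, 4591 / 10000⟩ from rfl] at r31
  rw [z32, show endBox (cix 3 2) = ⟨2313 / 100000, 2936 / 100000⟩ from rfl] at r32
  rw [z40, show endBox (cix 4 0) = ⟨9896 / 10000, 1110 / 1000⟩ from rfl] at r40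
  rw [z41, show endBox (cix 4 1) = ⟨1447 / 100000, 1534 / 10000⟩ from rfl] at r41
  rw [z42, show endBox (cix 4 2) = ⟨-(7222 / 1000000000), 2625 / 100000000⟩ from rfl] at r42
  rw [z50, show endBox (cix 5 0) = ⟨-(1916 / 1000000), 1091 / 100000⟩ from rfl] at r50
  rw [z51, show endBox (cix 5 1) = ⟨-(2925 / 100000000000), 6593 / 100000000000⟩ from rfl] at r51
  rw [z52, show endBox (cix 5 2) = ⟨-(1126 / 1000000000000), 1126 / 1000000000000⟩ from rfl] at r52
  push_cast at r00 r01 r02 r10 r11 r12 r20 r21 r22 r30 r31 r32 r40 r41 r42 r50 r51 r52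
  -- energies
  have hE3 := sum_F_le_energyHi H hθbox hTT.1 hTT.2 hT 3 (by norm_num) (by norm_num)
  have hE4 := sum_F_le_energyHi H hθbox hTT.1 hTT.2 hT 4 (by norm_num) (by norm_num)
  have hE5 := sum_F_le_energyHi H hθbox hTT.1 hTT.2 hT 5 (by norm_num) (by norm_num)
  norm_num at hE3 hE4 hE5
  obtain ⟨hc3, hc4, hc5⟩ := hEcap
  have hc3' := (Rat.cast_le (K := ℝ)).2 hc3; have hc4' := (Rat.cast_le (K := ℝ)).2 hc4
  have hc5' := (Rat.cast_le (K := ℝ)).2 hc5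
  simp only [ecap] at hc3' hc4' hc5'; push_cast at hc3' hc4' hc5'
  -- correlated clauses
  have hsum12 := TM.contains_add (hT (cix 4 0)) (hT (cix 5 0))
  rw [z40, z50] at hsum12
  have hs12lo := TM.lo2_le _ hθbox hsum12; have hs12hi := TM.le_hi2 _ hθbox hsum12
  have hx12lo := (Rat.cast_le (K := ℝ)).2 hx12.1; have hx12hi := (Rat.cast_le (K := ℝ)).2 hx12.2
  push_cast at hx12lo hx12hi
  have hcc2 := TM.le_hi2 _ hθbox (TM.contains_add (hT (cix 5 0)) (TM.contains_smul (-(10 / 19)) (TM.contains_sq hθbox (hT (cix 4 1)))))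
  rw [z50, z41] at hcc2
  have hc2' := (Rat.cast_le (K := ℝ)).2 hc2; push_cast at hc2' hcc2
  have hcpre := TM.le_hi2 _ hθbox (TM.contains_add (hT (cix 4 1)) (TM.contains_smul (-(38 / 100) * (4175 / 10000)) (hT (cix 4 0))))
  rw [z41, z40] at hcpre
  have hpre' := (Rat.cast_le (K := ℝ)).2 hpre; push_cast at hpre' hcpre
  -- integrals
  have hI1' := (Rat.cast_le (K := ℝ)).2 hI.1; have hI2' := (Rat.cast_le (K := ℝ)).2 hI.2
  push_cast at hI1' hI2'
  refine ⟨?_, ?_, ?_, ?_, ?_⟩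
  · unfold Window2.PhaseIEndBox
    refine ⟨⟨by linarith only [r00.1], by linarith only [r00.2]⟩, ⟨by linarith only [r01.1], by linarith only [r01.2]⟩,
      ⟨by linarith only [r02.1], by linarith only [r02.2]⟩, ⟨by linarith only [r10.1], by linarith only [r10.2]⟩,
      ⟨by linarith only [r11.1], by linarith only [r11.2]⟩, ⟨by linarith only [r12.1], by linarith only [r12.2]⟩,
      ⟨by linarith only [r20.1], by linarith only [r20.2]⟩, ⟨by linarith only [r21.1], by linarith only [r21.2]⟩,
      ⟨by linarith only [r22.1], by linarith only [r22.2]⟩, ⟨by linarith only [r30.1], by linarith only [r30.2]⟩,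
      ⟨by linarith only [r31.1], by linarith only [r31.2]⟩, ⟨by linarith only [r32.1], by linarith only [r32.2]⟩,
      ⟨by linarith only [r40.1], by linarith only [r40.2]⟩, ⟨by linarith only [r41.1], by linarith only [r41.2]⟩,
      ⟨by linarith only [r42.1], by linarith only [r42.2]⟩, ⟨by linarith only [r50.1], by linarith only [r50.2]⟩,
      ⟨by linarith only [r51.1], by linarith only [r51.2]⟩, ⟨by linarith only [r52.1], by linarith only [r52.2]⟩,
      by linarith only [hE3, hc3'], by linarith only [hE4, hc4'], by linarith only [hE5, hc5'],
      ⟨by linarith only [hs12lo, hx12lo], by linarith only [hs12hi, hx12hi]⟩, ?_, by linarith only [hcpre, hpre']⟩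
    have e : S 1 1 Window2.Tstar ^ 2 = S 1 1 Window2.Tstar * S 1 1 Window2.Tstar := sq _
    rw [e]; linarith only [hcc2, hc2']
  · intro s hs
    exact (henv (by norm_num) s ⟨hs.1, hs.2⟩).1
  · intro s hs i k hk0 hk2 hi3
    exact (henv (by norm_num) s ⟨hs.1, hs.2⟩).2 i k hk0 hk2 hi3
  · unfold Window2.iota₁; linarith only [hI1, hI1']
  · unfold Window2.iota₂; linarith only [hI2, hI2']

end Summit.NavierStokesRegularity.NavierStokesRegularity.Cruxes.RelayFrontStep.PhaseI

end
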